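import Summits.AtomisticToContinuum.FouriersLaw.Theorems.BondHeatUncertaintySubdiffusiveBondHeatJunctionRatioFirstBondTransfer

/-!
# `JunctionRatioFirstBondBracket` — file 19b: the EXPLICIT TRANSFER OBSERVABLE — bracket identity ∧ `N`-uniform local moment ⟹ first-bond transfer
# (cell `decomp-a2c`, lens-1 «grading / quantitative ladder», gen 63; beneath file 19a `…JunctionRatioFirstBondTransfer`; target 11071)

File 19a typed the line `RR ∧ EP ∧ FB ⟹ RootThermalisation 1` with the `N`-uniform piece [FB] `FirstBondTransferAt … C`
(`|½ − τ₁| ≤ C·√(T³‖g₀‖²)`).  Modulo the fixed-`N` pieces [FB] is only the Cauchy–Schwarz SHADOW of the mechanism; this file types the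
mechanism itself, so that NO piece of the line is a re-normalisation of the target:

* `transferTest β N i j` — `ψ = p_j / V″(q_j − q_i)` (`V″(r) = 1 + 3βr² ≥ 1`); `transferObservable … N i j` — the EXPLICIT local observable
  `Ψ = L(Lψ) − γ·Lψ + (U″(q_i) + V″(q_j − q_i))·ψ`, `L = (pinnedChain …).generator N T T` (the Literature generator at equal bath temperatures),
  `U″(q) = ω₂ + 3·lam·q²`.  Hot: `(i, j) = (0, 1)`; cold: `(i, j) = (N − 1, N − 2)`.  `Ψ` depends on sites `i, j` and their neighbours only.
* [BI] `FirstBondBracketAt … N` (`N ≥ 3`): THE BRACKET IDENTITY `τ₁ − ½ = T·∫ Ψ_hot·g₀ dμ₀` and `τ_{N−2} + ½ = T·∫ Ψ_cold·g_{N−1} dμ₀` for every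
  response density, tap scores and depth-two coefficients.  Derivation (file 18a (S1)–(S3)): `w := h − H/(2T²)` solves `L†w = (γ/T²)(p²_{N−1} − T)`;
  `[∂_{p₀}, L†] = −∂_{q₀} − γ∂_{p₀}` ⟹ `∂_{q₀}w = (L† − γ)g₀`; `[∂_{q₀}, L†] = (U″ + V″)∂_{p₀} − V″(r₀)∂_{p₁}` ⟹ `V″(r₀)∂_{p₁}w = L†∂_{q₀}w + (U″ + V″)g₀`;
  pair with `ψ`: `⟨p₁, ∂_{p₁}w⟩₀ = ⟨Ψ, g₀⟩₀`, and `⟨p₁, ∂_{p₁}w⟩₀ = ⟨p₁²/T − 1, w⟩₀ = (τ₁ − ½)/T` (`⟨p₁² − T, H⟩₀ = T²`).  Harmonic check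
  (`Ψ = p₀ − p₁ + p₂ − (γ/V″)F₁(q)`): identity to `1.2·10⁻¹²` on nine parameter sets (g62 `calib/out-bracket.txt`).  FIXED-`N` IDENTITY ·
  UNDECIDED · ATTACKABLE (first-order bookkeeping: hypoelliptic regularity of `h`, three integrations by parts against `μ₀`) · harmonic-TRUE. [piece · fixed N]
* [LM] `TransferMomentAt … M`: `∃ N₂ ∀ N ≥ N₂`: `Ψ_hot, Ψ_cold ∈ L²(μ₀^N)` with `∫Ψ² dμ₀^N ≤ M` — `N`-UNIFORM LOCAL GIBBS MOMENT (`Ψ` is a polynomial in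
  `p_i, p_j, p_{j±1}`, `q`'s of four sites, `U‴, V‴, V⁗` and `1/V″ ≤ 1`; uniform log-concavity `U″ ≥ ω₂`, `V″ ≥ 1`: Brascamp–Lieb, or the tree's
  transfer-operator moment files `…GibbsPositionEighthMoment*`, `…GibbsMomentumFourthMoment`, `…LocalEnergyMoment`).  `N`-UNIFORM · UNDECIDED ·
  ATTACKABLE · KNOWN-technique · harmonic-TRUE (`‖Ψ‖ = 2.4495` for `N = 6, 8` at `(1,1,1,1)`). [piece · N-uniform]

PROVED here: `abs_integral_mul_le_sqrt_mul_sqrt` (Cauchy–Schwarz in `L²(μ)`, from Mathlib's Hölder `integral_mul_norm_le_Lp_mul_Lq`);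
`firstBondTransferAt_of_bracket_of_moment : (∀ N, BI_N) ∧ LM(M) ⟹ FirstBondTransferAt … √(max M 0 / T)`; globals `FirstBondBracket`, `TransferMoment`,
`firstBondTransfer_of_bracket_of_moment`; THE FULL LINE `rootThermalisation_one_of_bracket : ResponseRegularity ∧ FirstOrderEntropyProduction ∧
FirstBondBracket ∧ TransferMoment ⟹ RootThermalisation 1` (⟹ `RootPositivity 1`, `rootPositivity_one_of_bracket`), and 11071 BY NAME
`boundedResponse_of_bracket_of_peeled_of_escapeInfZero_of_subOhmicBootstrap`.  NET EFFECT: the contact leaf [RP_1] of the node of record is reduced to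
FOUR ATTACKABLE pieces NONE of which is `N → ∞`-hard: three fixed-`N` first-order facts ([RR], [EP], [BI]) and one `N`-uniform equilibrium moment ([LM]).
No `sorry`; standard axioms; imports only file 19a.
-/

noncomputable section

open MeasureTheory Filter Topology Set
open scoped BigOperators

namespace Summit.AtomisticToContinuum.FouriersLaw.Theorems.SubdiffusiveBondHeat

namespace EscapeGrading

open Literature.MathematicalPhysics.KineticTheory.HeatConduction
open Summit.AtomisticToContinuum.FouriersLaw.Theses.BondHeatUncertainty (BoundedResponse NonBallistic)
open Summit.AtomisticToContinuum.FouriersLaw.Theorems.SubdiffusiveBondHeat.JunctionDefectGrading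

/-! ## A. Cauchy–Schwarz in `L²(μ)` -/

/-- `|∫ f·g dμ| ≤ √(∫ f² dμ)·√(∫ g² dμ)` for `f, g ∈ L²(μ)` (Mathlib's Hölder inequality at `p = q = 2`). [folklore] -/
theorem abs_integral_mul_le_sqrt_mul_sqrt {α : Type*} [MeasurableSpace α] {μ : Measure α} {f g : α → ℝ}
    (hf : MemLp f 2 μ) (hg : MemLp g 2 μ) :
    |∫ a, f a * g a ∂μ| ≤ Real.sqrt (∫ a, f a ^ 2 ∂μ) * Real.sqrt (∫ a, g a ^ 2 ∂μ) := by
  have h1 : |∫ a, f a * g a ∂μ| ≤ ∫ a, ‖f a‖ * ‖g a‖ ∂μ := by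
    calc |∫ a, f a * g a ∂μ| ≤ ∫ a, |f a * g a| ∂μ := abs_integral_le_integral_abs
      _ = ∫ a, ‖f a‖ * ‖g a‖ ∂μ := by
          congr 1
          ext a
          rw [abs_mul, Real.norm_eq_abs, Real.norm_eq_abs]
  have hf' : MemLp f (ENNReal.ofReal 2) μ := by simpa using hf
  have hg' : MemLp g (ENNReal.ofReal 2) μ := by simpa using hg
  have h2 := integral_mul_norm_le_Lp_mul_Lq Real.HolderConjugate.two_two hf' hg'
  have e : ∀ u : α → ℝ, (∫ a, ‖u a‖ ^ (2 : ℝ) ∂μ) ^ (1 / (2 : ℝ)) = Real.sqrt (∫ a, u a ^ 2 ∂μ) := by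
    intro u
    rw [Real.sqrt_eq_rpow]
    congr 1
    congr 1
    ext a
    rw [Real.norm_eq_abs, Real.rpow_two, sq_abs]
  rw [e f, e g] at h2
  exact h1.trans h2

/-! ## B. The explicit transfer observable -/

/-- The test function `ψ = p_j / V″(q_j − q_i)`, `V″(r) = 1 + 3βr²` (`≥ 1` for `β ≥ 0`). [notion · explicit] -/
def transferTest (β : ℝ) (N : ℕ) (i j : Fin N) (x : PhaseSpace N) : ℝ :=
  x.2 j / (1 + 3 * β * (x.1 j - x.1 i) ^ 2)

/-- **The transfer observable** `Ψ = L(Lψ) − γ·Lψ + (U″(q_i) + V″(q_j − q_i))·ψ`, `L = generator N T T` of the pinned chain (equal baths `T`),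
`U″(q) = ω₂ + 3·lam·q²`, `ψ = transferTest β N i j`.  Hot: `(i, j) = (0, 1)`; cold: `(N − 1, N − 2)`.  Harmonic case: `p₀ − p₁ + p₂ − (γ/V″)·F₁(q)`.
[notion · explicit] -/
def transferObservable (ω₂ lam β γ T : ℝ) (N : ℕ) (i j : Fin N) (x : PhaseSpace N) : ℝ :=
  (pinnedChain ω₂ lam β γ).generator N T T ((pinnedChain ω₂ lam β γ).generator N T T (transferTest β N i j)) x
    - γ * (pinnedChain ω₂ lam β γ).generator N T T (transferTest β N i j) x
    + (ω₂ + 3 * lam * x.1 i ^ 2 + (1 + 3 * β * (x.1 j - x.1 i) ^ 2)) * transferTest β N i j x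

/-! ## C. The two pieces behind [FB] -/

/-- **[BI] The first-bond bracket identity** (`N ≥ 3`): for every response density `h`, tap scores `g₀`, `g_{N−1}` and depth-two coefficients
`τ₁`, `τ_{N−2}`: `τ₁ − ½ = T·∫ Ψ_hot·g₀ dμ₀` and `τ_{N−2} + ½ = T·∫ Ψ_cold·g_{N−1} dμ₀` (commutator transfer of the linearised stationarity equation,
file docstring).  FIXED-`N` IDENTITY · UNDECIDED · ATTACKABLE · harmonic-TRUE. [piece · fixed N] -/
def FirstBondBracketAt (ω₂ lam β γ T : ℝ) (N : ℕ) : Prop :=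
  ∀ (_hN : 3 ≤ N), ∀ h g₀ g₁ : PhaseSpace N → ℝ, ∀ τ τ' : ℝ,
    IsResponseDensityAt ω₂ lam β γ T N h →
    IsTapScoreAt ω₂ lam β γ T N ⟨0, by omega⟩ (1 / (2 * T ^ 2)) h g₀ →
    IsTapScoreAt ω₂ lam β γ T N ⟨N - 1, by omega⟩ (-(1 / (2 * T ^ 2))) h g₁ →
    IsMomentCoefficientAt ω₂ lam β γ T N ⟨1, by omega⟩ τ →
    IsMomentCoefficientAt ω₂ lam β γ T N ⟨N - 1 - 1, by omega⟩ τ' →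
      τ - 1 / 2 = T * ∫ x, transferObservable ω₂ lam β γ T N ⟨0, by omega⟩ ⟨1, by omega⟩ x * g₀ x
          ∂((pinnedChain ω₂ lam β γ).gibbsMeasure N T) ∧
      τ' + 1 / 2 = T * ∫ x, transferObservable ω₂ lam β γ T N ⟨N - 1, by omega⟩ ⟨N - 1 - 1, by omega⟩ x * g₁ x
          ∂((pinnedChain ω₂ lam β γ).gibbsMeasure N T)

/-- **[LM] `N`-uniform local moment of the transfer observables** with bound `M`: `∃ N₂ ∀ N ≥ N₂` (`N ≥ 3`): `Ψ_hot, Ψ_cold ∈ L²(μ₀^N)` and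
`∫ Ψ² dμ₀^N ≤ M`.  `N`-UNIFORM · UNDECIDED · ATTACKABLE · KNOWN-technique (uniformly log-concave Gibbs state; tree `…GibbsPositionEighthMoment*`). [piece · N-uniform] -/
def TransferMomentAt (ω₂ lam β γ T M : ℝ) : Prop :=
  ∃ N₂ : ℕ, ∀ N : ℕ, N₂ ≤ N → ∀ (_hN : 3 ≤ N),
    MemLp (transferObservable ω₂ lam β γ T N ⟨0, by omega⟩ ⟨1, by omega⟩) 2 ((pinnedChain ω₂ lam β γ).gibbsMeasure N T) ∧
    (∫ x, transferObservable ω₂ lam β γ T N ⟨0, by omega⟩ ⟨1, by omega⟩ x ^ 2 ∂((pinnedChain ω₂ lam β γ).gibbsMeasure N T)) ≤ M ∧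
    MemLp (transferObservable ω₂ lam β γ T N ⟨N - 1, by omega⟩ ⟨N - 1 - 1, by omega⟩) 2 ((pinnedChain ω₂ lam β γ).gibbsMeasure N T) ∧
    (∫ x, transferObservable ω₂ lam β γ T N ⟨N - 1, by omega⟩ ⟨N - 1 - 1, by omega⟩ x ^ 2 ∂((pinnedChain ω₂ lam β γ).gibbsMeasure N T)) ≤ M

/-! ## D. [BI] ∧ [LM] ⟹ [FB]; the full line; the door by name -/

/-- **`(∀ N, BI_N) ∧ LM(M) ⟹ FirstBondTransferAt … √(max M 0 / T)`** (`T > 0`): Cauchy–Schwarz `|T∫Ψg₀| ≤ T‖Ψ‖‖g₀‖ ≤ T√M·‖g₀‖ =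
√(M/T)·√(T³‖g₀‖²)`. [this file · composition] -/
theorem firstBondTransferAt_of_bracket_of_moment {ω₂ lam β γ T M : ℝ} (hT : 0 < T)
    (hB : ∀ N : ℕ, FirstBondBracketAt ω₂ lam β γ T N) (hM : TransferMomentAt ω₂ lam β γ T M) :
    FirstBondTransferAt ω₂ lam β γ T (Real.sqrt (max M 0 / T)) := by
  obtain ⟨N₂, hM'⟩ := hM
  refine ⟨N₂, fun N hN hN3 h g₀ g₁ τ τ' hh hg₀ hg₁ hτ hτ' => ?_⟩
  obtain ⟨hΨ₀, hM₀, hΨ₁, hM₁⟩ := hM' N hN hN3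
  obtain ⟨e₀, e₁⟩ := hB N hN3 h g₀ g₁ τ τ' hh hg₀ hg₁ hτ hτ'
  have hM0 : 0 ≤ max M 0 := le_max_right _ _
  -- the algebra `√(M⁺/T)·√(T³ I) = T·(√M⁺·√I)`
  have key : ∀ I : ℝ, 0 ≤ I → Real.sqrt (max M 0 / T) * Real.sqrt (T ^ 3 * I) = T * (Real.sqrt (max M 0) * Real.sqrt I) := by
    intro I hI
    rw [← Real.sqrt_mul (div_nonneg hM0 hT.le), ← Real.sqrt_mul hM0,
      show max M 0 / T * (T ^ 3 * I) = T ^ 2 * (max M 0 * I) by rw [div_mul_eq_mul_div, div_eq_iff hT.ne']; ring,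
      Real.sqrt_mul (sq_nonneg T), Real.sqrt_sq hT.le]
  -- the Cauchy–Schwarz step, both ends
  have cs : ∀ (Ψ g : PhaseSpace N → ℝ), MemLp Ψ 2 ((pinnedChain ω₂ lam β γ).gibbsMeasure N T) →
      (∫ x, Ψ x ^ 2 ∂((pinnedChain ω₂ lam β γ).gibbsMeasure N T)) ≤ M → MemLp g 2 ((pinnedChain ω₂ lam β γ).gibbsMeasure N T) →
      |T * ∫ x, Ψ x * g x ∂((pinnedChain ω₂ lam β γ).gibbsMeasure N T)|
        ≤ Real.sqrt (max M 0 / T) * Real.sqrt (T ^ 3 * ∫ x, g x ^ 2 ∂((pinnedChain ω₂ lam β γ).gibbsMeasure N T)) := by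
    intro Ψ g hΨ hΨM hg
    have hI : 0 ≤ ∫ x, g x ^ 2 ∂((pinnedChain ω₂ lam β γ).gibbsMeasure N T) := integral_nonneg fun x => sq_nonneg _
    rw [key _ hI, abs_mul, abs_of_pos hT]
    refine mul_le_mul_of_nonneg_left ?_ hT.le
    calc |∫ x, Ψ x * g x ∂((pinnedChain ω₂ lam β γ).gibbsMeasure N T)|
        ≤ Real.sqrt (∫ x, Ψ x ^ 2 ∂((pinnedChain ω₂ lam β γ).gibbsMeasure N T))
            * Real.sqrt (∫ x, g x ^ 2 ∂((pinnedChain ω₂ lam β γ).gibbsMeasure N T)) := abs_integral_mul_le_sqrt_mul_sqrt hΨ hg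
      _ ≤ Real.sqrt (max M 0) * Real.sqrt (∫ x, g x ^ 2 ∂((pinnedChain ω₂ lam β γ).gibbsMeasure N T)) :=
          mul_le_mul_of_nonneg_right (Real.sqrt_le_sqrt (hΨM.trans (le_max_left _ _))) (Real.sqrt_nonneg _)
  constructor
  · have e : (1 : ℝ) / 2 - τ = -(τ - 1 / 2) := by ring
    rw [e, abs_neg, e₀]
    exact cs _ _ hΨ₀ hM₀ hg₀.1
  · have e : (1 : ℝ) / 2 + τ' = τ' + 1 / 2 := by ring
    rw [e, e₁]
    exact cs _ _ hΨ₁ hM₁ hg₁.1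

/-- **[BI] global.** [piece · fixed N] -/
def FirstBondBracket : Prop :=
  ∀ ω₂ lam β γ : ℝ, 0 < ω₂ → 0 < lam → 0 < β → 0 < γ → ∀ T : ℝ, 0 < T → ∀ N : ℕ, FirstBondBracketAt ω₂ lam β γ T N

/-- **[LM] global:** for all parameters and `T > 0` there is `M` with `TransferMomentAt … M`. [piece · N-uniform] -/
def TransferMoment : Prop :=
  ∀ ω₂ lam β γ : ℝ, 0 < ω₂ → 0 < lam → 0 < β → 0 < γ → ∀ T : ℝ, 0 < T → ∃ M : ℝ, TransferMomentAt ω₂ lam β γ T M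

/-- `FirstBondBracket ∧ TransferMoment ⟹ FirstBondTransfer` (file 19a's [FB]). [this file · composition] -/
theorem firstBondTransfer_of_bracket_of_moment (hB : FirstBondBracket) (hM : TransferMoment) : FirstBondTransfer :=
  fun ω₂ lam β γ hω hl hβ hγ T hT => by
    obtain ⟨M, hM'⟩ := hM ω₂ lam β γ hω hl hβ hγ T hT
    exact ⟨_, firstBondTransferAt_of_bracket_of_moment hT (hB ω₂ lam β γ hω hl hβ hγ T hT) hM'⟩

/-- **THE FULL LINE: `ResponseRegularity ∧ FirstOrderEntropyProduction ∧ FirstBondBracket ∧ TransferMoment ⟹ RootThermalisation 1`.** [composition] -/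
theorem rootThermalisation_one_of_bracket (hR : ResponseRegularity) (hE : FirstOrderEntropyProduction) (hB : FirstBondBracket)
    (hM : TransferMoment) : RootThermalisation 1 :=
  rootThermalisation_one_of_transfer hR hE (firstBondTransfer_of_bracket_of_moment hB hM)

/-- `… ⟹ RootPositivity 1` — the contact leaf [RP_1] of the node of record, from four attackable pieces. [composition] -/
theorem rootPositivity_one_of_bracket (hR : ResponseRegularity) (hE : FirstOrderEntropyProduction) (hB : FirstBondBracket)
    (hM : TransferMoment) : RootPositivity 1 :=
  rootPositivity_of_rootThermalisation (rootThermalisation_one_of_bracket hR hE hB hM)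

/-- **11071 BY NAME: `(∀ ρ < 1, PeeledLocalityLaw ρ 1) ∧ RR ∧ EP ∧ BI ∧ LM ∧ EscapeInfZero ∧ SubOhmicBootstrap ⟹ BoundedResponse`.** [frame] -/
theorem boundedResponse_of_bracket_of_peeled_of_escapeInfZero_of_subOhmicBootstrap (hL : ∀ ρ : ℝ, ρ < 1 → PeeledLocalityLaw ρ 1)
    (hR : ResponseRegularity) (hE : FirstOrderEntropyProduction) (hB : FirstBondBracket) (hM : TransferMoment) (hI : EscapeInfZero)
    (hS : SubOhmicBootstrap) : BoundedResponse :=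
  boundedResponse_of_transfer_of_peeled_of_escapeInfZero_of_subOhmicBootstrap hL hR hE (firstBondTransfer_of_bracket_of_moment hB hM) hI hS

/-- `(∀ ρ < 1, PeeledLocalityLaw ρ 1) ∧ RR ∧ EP ∧ BI ∧ LM ∧ NonBallistic ⟹ AsymptoticSeriesLaw` (floor partner = route item 9127). [frame] -/
theorem asymptoticSeriesLaw_of_bracket_of_peeled_of_nonBallistic (hL : ∀ ρ : ℝ, ρ < 1 → PeeledLocalityLaw ρ 1)
    (hR : ResponseRegularity) (hE : FirstOrderEntropyProduction) (hB : FirstBondBracket) (hM : TransferMoment) (hN : NonBallistic) :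
    AsymptoticSeriesLaw :=
  asymptoticSeriesLaw_of_transfer_of_peeled_of_nonBallistic hL hR hE (firstBondTransfer_of_bracket_of_moment hB hM) hN

end EscapeGrading

end Summit.AtomisticToContinuum.FouriersLaw.Theorems.SubdiffusiveBondHeat

end
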